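import Summits.HodgeConjecture.HodgeConjecture.Theorems.Ring2AbelianAllAndreLerayIdempotentSuppliers
import HarnessLib

/-!
# Ring 2 · sub-cell AbelianAll (ALL ABELIAN VARIETIES), André axis, part XXVII-c — THE ALGEBRAIC LERAY IDEMPOTENT at node level:
# `HC_AV ⟺ HC_CM ∧ [the Hodge conjecture for the images of the algebraic Leray idempotents at CM points]`, modulo [h₂₁, Verdier] and
# the display-only bracket `CMLerayIdempotent[]` ⟸ `CMWeights[]` ⟸ `PencilTheta[]` (θ∀)

HONEST FRAMING (page 1, verbatim): **research route, not a corollary; conditional on HC_CM plus one named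
minimal statement.** Cell line: research route conditional on HC_CM; not a corollary; Q11.4-sentence-2
already refuted in dim ≥ 3. Nothing in this file proves a case of the Hodge conjecture for an abelian variety; `HC_CM`
(`RankFourFaces.CMAbelianHodge`) is a HYPOTHESIS of the rows that name it, load-bearing as typed; item `Theses.RankFourFaces.CMToAbelian`
(stmt-16267) OPEN and not closed here. Seat `pub-hodge-ring2-ab-andre-2`, gen 19; brief (ii) "record each version".

## What is proved (theorems only; no definition, no named fact, no sorry)

Display-only brackets (`local notation3`, no `def`, not census nodes — REFEREE-AB F-ab-103; `CMWeights[]`, `CMTopWeightHodge[]`,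
`PencilTheta[]` restated verbatim from parts XXIV-c/d, XXVI-b):
* **`CMLerayIdempotent[]`** — on every compact pencil of abelian `d`-folds, at every CM point `t`, in every degree `2p ≤ 2d`, there is an
  ALGEBRAIC LERAY IDEMPOTENT: an endomorphism `e` of `H^{2p}(𝒳(ℂ); ℂ)` induced by an algebraic cycle on `𝒳 × 𝒳` (Π1), preserving rational
  classes (Π2), with `j_t^* ∘ e = j_t^*` (π) and `e|_{ker j_t^*} = 0` (κ). In print: the Leray projector onto `H⁰(S, R^{2p} f_*ℚ) ⊂
  H^{2p}(𝒳, ℚ)` is algebraic — for abelian schemes the `θ_n`-Vandermonde formula (Deninger–Murre Thm. 3.1, Künnemann); THE WEAKEST FORM OF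
  THE ANDRÉ-AXIS WEIGHT HYPOTHESIS ACTUALLY USED (parts XXIV–XXVI used (θ∀) only to build this `e`). OPEN on the carriers; displayed.
* **`CMIdempotentHodge[]`** — at CM points, for EVERY such `e`: the rational `(p,p)`-classes fixed by `e` are algebraic ("the Hodge conjecture
  for `Im e`"); **`CMIdempotentLifts[]`** — for every such `e`: the `e`-fixed classes with algebraic restriction to `X_t` are algebraic.
Edges (all K): `cmLerayIdempotent_of_cmWeights` (the Lagrange idempotent of part XXVII-b; degree `0`: `e = id`), `cmLerayIdempotent_of_pencilTheta`;
`cmIdempotentLifts_of_cmFibreAlgebraicLift`, `cmFibreAlgebraicLift_of_cmIdempotentLifts` (mod `CMLerayIdempotent[]`), `cmFibreAlgebraicLift_iff_cmIdempotentLifts`;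
`cmIdempotentHodge_of_cmFibreAlgebraicLift_of_HC_CM` (K[HC_CM]), `cmFibreAlgebraicLift_of_cmIdempotentHodge` (mod `CMLerayIdempotent[]`),
on-path `cmIdempotentHodge_of_HC_AV_of_verdier`; `cmTopWeightHodge_of_cmIdempotentHodge` (K, no side hypothesis) and
`cmIdempotentHodge_of_cmTopWeightHodge` (mod `CMWeights[]`; part XXVII-a's independence of the idempotent), `cmIdempotentHodge_iff_cmTopWeightHodge`.
Rows: **`HC_AV_of_HC_CM_of_cmIdempotentHodge (h₂₁) (hE : CMLerayIdempotent[]) (hCM) (h)`**, **`HC_AV_iff_HC_CM_and_cmIdempotentHodge_of_verdier`**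
(mod [h₂₁, Verdier, `CMLerayIdempotent[]`]), the `_of_theta` forms (mod (θ∀) `PencilTheta[]`), and the W₆ row in idempotent form
**`weilSixfolds_of_cmPowerWeilPencilsAt_of_idempotentHodge`** (`HC_CM` idle).

## Honest status

No node is born; nothing is minimal; nothing here is fact-free progress on `HC_AV`. WHAT CHANGES: the displayed hypothesis of the André-axis
exactness rows is now `CMLerayIdempotent[]` — ONE algebraic cycle per (pencil, CM point, degree) with a linear-algebra specification — in
place of the abelian-scheme endomorphism (θ∀); it is implied by (θ∀) (K, through the weights) and is what (θ∀) was used for. The `B_min`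
CANDIDATE (4-binder reading of (L); not below N104, not minimal — F-ab-107's wording applies verbatim) reads: "the Hodge conjecture for the
image of an (any) algebraic Leray idempotent of the total space of a CM-pointed compact abelian pencil", independent of the idempotent
chosen (part XXVII-a `forall_fixed_hodge_mem_iff_of_two`). FIND-THE-CYCLE (W₆, large monodromy): on the sevenfold `𝒳⁷ → S` with an
`E`-power fibre, (i) an algebraic 7-cycle on `𝒳 × 𝒳` acting on `H⁶(𝒳)` as a Leray idempotent at the `E`-power point (for an abelian
scheme: Deninger–Murre's projector), and (ii) algebraic 3-cycles representing the rank-3 space of rational Hodge classes in its image.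

References: DeningerMurre1991 (Thm. 3.1, Cor. 3.2); Kunnemann1994 (§2); Milne2020HodgeClassesAV (proof of Prop. 1, pp. 7–8); Kleiman1968AlgebraicCycles
(p. 374); Andre1996Motifs (§5.1, Lemme 6.3.1, Lemme 6.3.3, Remarque 2); Verdier1976 (Cor. 5.1); MumfordGIT (Thm. 6.14); vanGeemen1994HodgeAV (Thm. 6.12).
-/

noncomputable section

set_option linter.dupNamespace false

namespace Summit.HodgeConjecture.HodgeConjecture.Ring2.AbelianAll

open CategoryTheory AlgebraicGeometry
open Literature.AlgebraicGeometry Literature.AlgebraicGeometry.Motives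
open Literature.AlgebraicGeometry.HodgeTheory
open Literature.AlgebraicGeometry.Deligne1982 (cmLocus)
open Literature.AlgebraicGeometry.Andre1996 (andre1996_cmAnchoredPencil)
open Summit.HodgeConjecture.HodgeConjecture
open Summit.HodgeConjecture.HodgeConjecture.Theses
open Summit.HodgeConjecture.HodgeConjecture.Ring2.Deform (HC_CM_of_HC_AV)
open Summit.HodgeConjecture.HodgeConjecture.Ring2.Hypotheses (cmPowerLocus)

section Nodes

/-- DISPLAY-ONLY bracket (no `def`; REFEREE-AB F-ab-103): `CMWeights[]` of part XXIV-c, restated verbatim. -/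
local notation3 (prettyPrint := false) "CMWeights[]" =>
  ∀ ⦃d : ℕ⦄ ⦃𝒳 S : SchemeOver ℂ⦄ (f : 𝒳 ⟶ S), IsCompactAbelianPencil f d → ∀ t ∈ cmLocus f d,
    ∃ (ν : 𝒳 ⟶ 𝒳) (_ : LocallyQuasiFinite ν.left) (N : ℕ), 2 ≤ N ∧
      (∀ (k : ℕ) (w : complexBetti 𝒳 k), complexBetti.map (fiberι f t) k (complexBetti.map ν k w) =
        ((N : ℂ) ^ k) • complexBetti.map (fiberι f t) k w) ∧
      (∀ (k k₁ k₂ : ℕ), k₁ + 1 = k → k₂ + 1 = k₁ → ∀ w : complexBetti 𝒳 k, ∃ w₀ w₁ w₂ : complexBetti 𝒳 k,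
        w = w₀ + w₁ + w₂ ∧ complexBetti.map ν k w₀ = ((N : ℂ) ^ k) • w₀ ∧ complexBetti.map ν k w₁ = ((N : ℂ) ^ k₁) • w₁ ∧
        complexBetti.map ν k w₂ = ((N : ℂ) ^ k₂) • w₂) ∧
      (∀ (k : ℕ) (G : complexBetti 𝒳 k), complexBetti.map ν k G = ((N : ℂ) ^ k) • G →
        complexBetti.map (fiberι f t) k G = 0 → G = 0)

/-- DISPLAY-ONLY bracket (no `def`; REFEREE-AB F-ab-103): `CMTopWeightHodge[]` of part XXIV-d, restated verbatim. -/
local notation3 (prettyPrint := false) "CMTopWeightHodge[]" =>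
  ∀ ⦃d : ℕ⦄ ⦃𝒳 S : SchemeOver ℂ⦄ (f : 𝒳 ⟶ S), IsCompactAbelianPencil f d → ∀ t ∈ cmLocus f d,
    ∀ (ν : 𝒳 ⟶ 𝒳) (_ : LocallyQuasiFinite ν.left) (N : ℕ), 2 ≤ N →
      (∀ (k : ℕ) (w : complexBetti 𝒳 k), complexBetti.map (fiberι f t) k (complexBetti.map ν k w) =
        ((N : ℂ) ^ k) • complexBetti.map (fiberι f t) k w) →
      (∀ (k k₁ k₂ : ℕ), k₁ + 1 = k → k₂ + 1 = k₁ → ∀ w : complexBetti 𝒳 k, ∃ w₀ w₁ w₂ : complexBetti 𝒳 k,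
        w = w₀ + w₁ + w₂ ∧ complexBetti.map ν k w₀ = ((N : ℂ) ^ k) • w₀ ∧ complexBetti.map ν k w₁ = ((N : ℂ) ^ k₁) • w₁ ∧
        complexBetti.map ν k w₂ = ((N : ℂ) ^ k₂) • w₂) →
      (∀ (k : ℕ) (G : complexBetti 𝒳 k), complexBetti.map ν k G = ((N : ℂ) ^ k) • G →
        complexBetti.map (fiberι f t) k G = 0 → G = 0) →
      ∀ (p : ℕ) (y₀ : complexBetti 𝒳 (2 * (p + 1))),
        complexBetti.map ν (2 * (p + 1)) y₀ = ((N : ℂ) ^ (2 * (p + 1))) • y₀ → IsRationalClass y₀ →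
        IsOfHodgeType (d + 1) 𝒳 (2 * (p + 1)) (p + 1) (p + 1) y₀ → y₀ ∈ algebraicClasses 𝒳 (p + 1)

/-- DISPLAY-ONLY bracket (no `def`; REFEREE-AB F-ab-103): (θ∀) `PencilTheta[]` of part XXVI-b, restated verbatim. -/
local notation3 (prettyPrint := false) "PencilTheta[]" =>
  ∀ ⦃d : ℕ⦄ ⦃𝒳 S : SchemeOver ℂ⦄ (f : 𝒳 ⟶ S), IsCompactAbelianPencil f d → (cmLocus f d).Nonempty →
    ∃ (ν : 𝒳 ⟶ 𝒳) (_ : LocallyQuasiFinite ν.left) (N : ℕ), 2 ≤ N ∧ ν ≫ f = f ∧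
      ∀ s : ComplexPoints S, ∃ (νs : fiberOver f s ⟶ fiberOver f s) (A : AbelianVariety ℂ) (e : A.X ≅ fiberOver f s),
        νs ≫ fiberι f s = fiberι f s ≫ ν ∧ e.hom ≫ νs = (N • 𝟙 A).hom.hom.hom ≫ e.hom

/-- DISPLAY-ONLY bracket (no `def`; REFEREE-AB F-ab-103): **`CMLerayIdempotent[]` — algebraic Leray idempotents exist at CM points.** On every
compact pencil of abelian `d`-folds `f : 𝒳 ⟶ S`, at every CM point `t`, in every degree `2p ≤ 2d`, there is an endomorphism `e` of
`H^{2p}(𝒳(ℂ); ℂ)` which (Π1) is induced by an algebraic cycle on `𝒳 × 𝒳`, (Π2) preserves rational classes, (π) satisfies `j_t^* ∘ e = j_t^*`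
and (κ) kills `ker j_t^*`. In print: algebraicity of the Leray / relative Künneth projector onto `H⁰(S, R^{2p} f_*ℚ)` (abelian schemes:
Deninger–Murre Thm. 3.1 via `θ_n`; Künnemann); the WEAKEST FORM of the weight hypothesis of parts XXIV–XXVI actually used. OPEN on the
carriers (no group law over `S`); a HYPOTHESIS wherever used. -/
local notation3 (prettyPrint := false) "CMLerayIdempotent[]" =>
  ∀ ⦃d : ℕ⦄ ⦃𝒳 S : SchemeOver ℂ⦄ (f : 𝒳 ⟶ S), IsCompactAbelianPencil f d → ∀ t ∈ cmLocus f d, ∀ p : ℕ, p ≤ d →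
    ∃ e : complexBetti 𝒳 (2 * p) →ₗ[ℂ] complexBetti 𝒳 (2 * p),
      IsAlgebraicCorrespondence (d + 1) (d + 1) 𝒳 𝒳 e ∧ (∀ w, IsRationalClass w → IsRationalClass (e w)) ∧
      (∀ w, complexBetti.map (fiberι f t) (2 * p) (e w) = complexBetti.map (fiberι f t) (2 * p) w) ∧
      (∀ w, complexBetti.map (fiberι f t) (2 * p) w = 0 → e w = 0)

/-- DISPLAY-ONLY bracket (no `def`; REFEREE-AB F-ab-103): **`CMIdempotentLifts[]`** — at CM points, for EVERY algebraic Leray idempotent `e`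
((Π1), (π), (κ); (Π2) not needed) in degree `2p`: every `e`-fixed class whose restriction to `X_t` is algebraic IS algebraic. OPEN. -/
local notation3 (prettyPrint := false) "CMIdempotentLifts[]" =>
  ∀ ⦃d : ℕ⦄ ⦃𝒳 S : SchemeOver ℂ⦄ (f : 𝒳 ⟶ S), IsCompactAbelianPencil f d → ∀ t ∈ cmLocus f d,
    ∀ (p : ℕ) (e : complexBetti 𝒳 (2 * p) →ₗ[ℂ] complexBetti 𝒳 (2 * p)), IsAlgebraicCorrespondence (d + 1) (d + 1) 𝒳 𝒳 e →
      (∀ w, complexBetti.map (fiberι f t) (2 * p) (e w) = complexBetti.map (fiberι f t) (2 * p) w) →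
      (∀ w, complexBetti.map (fiberι f t) (2 * p) w = 0 → e w = 0) →
      ∀ y₀ : complexBetti 𝒳 (2 * p), e y₀ = y₀ →
        complexBetti.map (fiberι f t) (2 * p) y₀ ∈ algebraicClasses (fiberOver f t) p → y₀ ∈ algebraicClasses 𝒳 p

/-- DISPLAY-ONLY bracket (no `def`; REFEREE-AB F-ab-103): **`CMIdempotentHodge[]` — THE HODGE CONJECTURE FOR THE IMAGES OF THE ALGEBRAIC
LERAY IDEMPOTENTS AT CM POINTS.** At every CM point `t` of every compact pencil of abelian `d`-folds, for EVERY algebraic Leray idempotent `e`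
((Π1), (Π2), (π), (κ)) in degree `2p`: every RATIONAL `(p,p)`-class `y₀` with `e y₀ = y₀` is algebraic. `Im e` is a sub-Hodge structure of
`H^{2p}(𝒳, ℚ)`, a complement of `ker j_t^*`, read isomorphically on `X_t` (part XXVII-a); in print `H⁰(S, R^{2p} f_*ℚ)`. OPEN; a HYPOTHESIS. -/
local notation3 (prettyPrint := false) "CMIdempotentHodge[]" =>
  ∀ ⦃d : ℕ⦄ ⦃𝒳 S : SchemeOver ℂ⦄ (f : 𝒳 ⟶ S), IsCompactAbelianPencil f d → ∀ t ∈ cmLocus f d,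
    ∀ (p : ℕ) (e : complexBetti 𝒳 (2 * p) →ₗ[ℂ] complexBetti 𝒳 (2 * p)), IsAlgebraicCorrespondence (d + 1) (d + 1) 𝒳 𝒳 e →
      (∀ w, IsRationalClass w → IsRationalClass (e w)) →
      (∀ w, complexBetti.map (fiberι f t) (2 * p) (e w) = complexBetti.map (fiberι f t) (2 * p) w) →
      (∀ w, complexBetti.map (fiberι f t) (2 * p) w = 0 → e w = 0) →
      ∀ y₀ : complexBetti 𝒳 (2 * p), e y₀ = y₀ → IsRationalClass y₀ → IsOfHodgeType (d + 1) 𝒳 (2 * p) p p y₀ →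
        y₀ ∈ algebraicClasses 𝒳 p

/-! ### Where the idempotents come from -/

/-- **`CMWeights[] ⟹ CMLerayIdempotent[]`**: in degree `2p ≥ 2` the Lagrange polynomial in `ν^*` of part XXVII-b
(`exists_lerayIdempotent_of_weights`); in degree `0` the identity (`H⁰(𝒳) → H⁰(X_t)` is injective, part XXV-a `top_zero`).
[cite: Milne2020HodgeClassesAV, proof of Prop. 1 (p. 7)] [cite: DeningerMurre1991, Thm. 3.1] -/
theorem cmLerayIdempotent_of_cmWeights (hW : CMWeights[]) : CMLerayIdempotent[] := by
  intro d 𝒳 S f hf t ht p hp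
  cases p with
  | zero =>
    exact ⟨LinearMap.id, isAlgebraicCorrespondence_id hf.isSmoothProjective_total (by omega), fun _ hw ↦ hw, fun _ ↦ rfl,
      fun w hw ↦ top_zero hf t hw⟩
  | succ p =>
    obtain ⟨ν, _, N, hN, hwt, hwt₃, htop⟩ := hW f hf t ht
    obtain ⟨e, h₁, h₂, h₃, h₄, -⟩ := exists_lerayIdempotent_of_weights hf t ν hN (show p ≤ d by omega) (hwt _)
      (hwt₃ (2 * (p + 1)) (2 * p + 1) (2 * p) (by omega) (by omega)) (htop _)
    exact ⟨e, h₁, h₂, h₃, h₄⟩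

/-- **(θ∀) `PencilTheta[] ⟹ CMLerayIdempotent[]`** (through `CMWeights[]`, parts XXV–XXVI): the abelian-scheme endomorphism `θ_N` was used on
the André axis ONLY to produce these idempotents. [cite: MumfordGIT, Thm. 6.14] [cite: DeningerMurre1991, Thm. 3.1] -/
theorem cmLerayIdempotent_of_pencilTheta (hΘ : PencilTheta[]) : CMLerayIdempotent[] :=
  cmLerayIdempotent_of_cmWeights (cmWeights_of_pencilTheta hΘ)

/-! ### (L) ⟺ the idempotent brackets -/

/-- **(L) ⟹ `CMIdempotentLifts[]`** (part XXVII-a §4 ⟹; no side hypothesis). [cite: Milne2020HodgeClassesAV, proof of Prop. 1 (pp. 7–8)] -/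
theorem cmIdempotentLifts_of_cmFibreAlgebraicLift (hL : CMFibreAlgebraicLift) : CMIdempotentLifts[] := by
  intro d 𝒳 S f hf t ht p e halg hπ hκ
  exact (comap_le_sup_iff_forall_fixed_mem hf t e halg hπ hκ).1 (cmFibreAlgebraicLift_iff_comap_le_sup.1 hL f hf p t ht)

/-- **`CMIdempotentLifts[]` ⟹ (L), granted `CMLerayIdempotent[]`** (part XXVII-a §4 ⟸ at the supplied idempotent for `p ≤ d`; degrees `p > d`
are vacuous: `H^{2p}(X_t) = 0`). [cite: Milne2020HodgeClassesAV, proof of Prop. 1 (pp. 7–8)] [cite: Andre1996Motifs, §5.1 (p. 25)] -/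
theorem cmFibreAlgebraicLift_of_cmIdempotentLifts (hE : CMLerayIdempotent[]) (h : CMIdempotentLifts[]) : CMFibreAlgebraicLift := by
  refine cmFibreAlgebraicLift_iff_comap_le_sup.2 fun d 𝒳 S f hf p t ht ↦ ?_
  rcases le_or_gt p d with hp | hp
  · obtain ⟨e, halg, -, hπ, hκ⟩ := hE f hf t ht p hp
    exact (comap_le_sup_iff_forall_fixed_mem hf t e halg hπ hκ).2 (h f hf t ht p e halg hπ hκ)
  · haveI := subsingleton_complexBetti (hf.isSmoothProjective_fiberOver t) (show 2 * d < 2 * p by omega)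
    intro W _
    refine Submodule.mem_sup_right ?_
    rw [LinearMap.mem_ker]
    exact Subsingleton.elim _ _

/-- **(L) ⟺ `CMIdempotentLifts[]`, granted `CMLerayIdempotent[]`** — one more exact reading of the André-axis lift: "the canonical (`e`-fixed)
lifts of the algebraic classes of the CM fibres are algebraic". [cite: Milne2020HodgeClassesAV, proof of Prop. 1 (pp. 7–8)] -/
theorem cmFibreAlgebraicLift_iff_cmIdempotentLifts (hE : CMLerayIdempotent[]) : CMFibreAlgebraicLift ↔ CMIdempotentLifts[] :=
  ⟨cmIdempotentLifts_of_cmFibreAlgebraicLift, cmFibreAlgebraicLift_of_cmIdempotentLifts hE⟩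

/-- **`HC_CM ∧ (L) ⟹ CMIdempotentHodge[]`** (part XXVII-a §4 ⟹: at a CM fibre `HC_CM` makes the rational `(p,p)`-classes algebraic,
`Ring2Transport.mem_algebraicClasses_of_cmChart`). `HC_CM` a HYPOTHESIS, load-bearing. [cite: Milne2020HodgeClassesAV, proof of Prop. 1 (pp. 7–8)]
[cite: Andre1996Motifs, §5.1 (p. 25) and §6.3 (p. 33)] -/
theorem cmIdempotentHodge_of_cmFibreAlgebraicLift_of_HC_CM (hCM : RankFourFaces.CMAbelianHodge) (hL : CMFibreAlgebraicLift) :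
    CMIdempotentHodge[] := by
  intro d 𝒳 S f hf t ht p e halg _ hπ hκ
  obtain ⟨A₀, ⟨e₀⟩, hdim, hcm⟩ := ht
  exact fixed_hodge_mem_of_comap_le_sup hf t e halg hπ hκ
    (fun c hc hcpp ↦ Ring2Transport.mem_algebraicClasses_of_cmChart hCM A₀ e₀ hdim hcm hc hcpp)
    (cmFibreAlgebraicLift_iff_comap_le_sup.1 hL f hf p t ⟨A₀, ⟨e₀⟩, hdim, hcm⟩)

/-- **`CMIdempotentHodge[]` ⟹ (L), granted `CMLerayIdempotent[]`** (part XXVII-a §4 ⟸ at the supplied idempotent; degrees `p > d` vacuous).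
[cite: Milne2020HodgeClassesAV, proof of Prop. 1 (pp. 7–8)] [cite: Andre1996Motifs, §5.1 (p. 25)] -/
theorem cmFibreAlgebraicLift_of_cmIdempotentHodge (hE : CMLerayIdempotent[]) (h : CMIdempotentHodge[]) : CMFibreAlgebraicLift := by
  refine cmFibreAlgebraicLift_iff_comap_le_sup.2 fun d 𝒳 S f hf p t ht ↦ ?_
  rcases le_or_gt p d with hp | hp
  · obtain ⟨e, halg, hQ, hπ, hκ⟩ := hE f hf t ht p hp
    exact comap_le_sup_of_forall_fixed_hodge_mem hf t e halg hQ hπ hκ (h f hf t ht p e halg hQ hπ hκ)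
  · haveI := subsingleton_complexBetti (hf.isSmoothProjective_fiberOver t) (show 2 * d < 2 * p by omega)
    intro W _
    refine Submodule.mem_sup_right ?_
    rw [LinearMap.mem_ker]
    exact Subsingleton.elim _ _

/-- **ON-PATH: `HC_AV ⟹ CMIdempotentHodge[]`** (granted Verdier 1976 for part XX's spreading; `HC_AV ⟹ HC_CM` is the tree's).
[cite: Verdier1976, Cor. 5.1] [cite: Andre1996Motifs, §6.3 (p. 33)] -/
theorem cmIdempotentHodge_of_HC_AV_of_verdier (hGT : Verdier1976_genericLocalTriviality) (h : PadicSemiregularLift.HodgeAbelianVarieties) :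
    CMIdempotentHodge[] :=
  cmIdempotentHodge_of_cmFibreAlgebraicLift_of_HC_CM (HC_CM_of_HC_AV h) (cmFibreAlgebraicLift_of_HC_AV_of_verdier hGT h)

/-! ### The two Hodge brackets agree -/

/-- **`CMIdempotentHodge[] ⟹ CMTopWeightHodge[]`** (K, no side hypothesis): the weights of the endomorphism supplied to `CMTopWeightHodge[]`
give the Lagrange idempotent (part XXVII-b), whose fixed classes are the top-weight classes; degrees above `2(d+1)` are vacuous.
[cite: Milne2020HodgeClassesAV, proof of Prop. 1 (pp. 7–8)] -/
theorem cmTopWeightHodge_of_cmIdempotentHodge (h : CMIdempotentHodge[]) : CMTopWeightHodge[] := by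
  intro d 𝒳 S f hf t ht ν _ N hN hwt hwt₃ htop p y₀ hy₀ hQ hH
  rcases le_or_gt p d with hp | hp
  · obtain ⟨e, halg, hQe, hπ, hκ, hfix⟩ := exists_lerayIdempotent_of_weights hf t ν hN hp (hwt _)
      (hwt₃ (2 * (p + 1)) (2 * p + 1) (2 * p) (by omega) (by omega)) (htop _)
    exact h f hf t ht (p + 1) e halg hQe hπ hκ y₀ ((hfix y₀).2 hy₀) hQ hH
  · haveI := subsingleton_complexBetti hf.isSmoothProjective_total (show 2 * (d + 1) < 2 * (p + 1) by omega)
    rw [Subsingleton.elim y₀ 0]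
    exact Submodule.zero_mem _

/-- **`CMTopWeightHodge[] ⟹ CMIdempotentHodge[]`, granted `CMWeights[]`**: at an arbitrary idempotent `e` the reading is transported from the
Lagrange idempotent of the supplied weights by part XXVII-a's `forall_fixed_hodge_mem_of_two` (degree `0`: every class is algebraic).
[cite: Milne2020HodgeClassesAV, proof of Prop. 1 (pp. 7–8)] [cite: DeningerMurre1991, Cor. 3.2] -/
theorem cmIdempotentHodge_of_cmTopWeightHodge (hW : CMWeights[]) (h : CMTopWeightHodge[]) : CMIdempotentHodge[] := by
  intro d 𝒳 S f hf t ht p e halg hQ hπ hκ y₀ hy₀ hyQ hyH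
  cases p with
  | zero =>
    rw [algebraicClasses_zero]
    exact Submodule.mem_top
  | succ p =>
    rcases le_or_gt p d with hp | hp
    · obtain ⟨ν, _, N, hN, hwt, hwt₃, htop⟩ := hW f hf t ht
      obtain ⟨e', halg', hQ', hπ', hκ', hfix⟩ := exists_lerayIdempotent_of_weights hf t ν hN hp (hwt _)
        (hwt₃ (2 * (p + 1)) (2 * p + 1) (2 * p) (by omega) (by omega)) (htop _)
      have h' : ∀ y : complexBetti 𝒳 (2 * (p + 1)), e' y = y → IsRationalClass y →
          IsOfHodgeType (d + 1) 𝒳 (2 * (p + 1)) (p + 1) (p + 1) y → y ∈ algebraicClasses 𝒳 (p + 1) :=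
        fun y hy hyQ' hyH' ↦ h f hf t ht ν inferInstance N hN hwt hwt₃ htop p y ((hfix y).1 hy) hyQ' hyH'
      exact forall_fixed_hodge_mem_of_two hf t e' e halg' hQ' hπ' hκ' halg hκ h' y₀ hy₀ hyQ hyH
    · haveI := subsingleton_complexBetti hf.isSmoothProjective_total (show 2 * (d + 1) < 2 * (p + 1) by omega)
      rw [Subsingleton.elim y₀ 0]
      exact Submodule.zero_mem _

/-- **`CMIdempotentHodge[] ⟺ CMTopWeightHodge[]`, granted `CMWeights[]`.** [cite: Milne2020HodgeClassesAV, proof of Prop. 1 (pp. 7–8)] -/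
theorem cmIdempotentHodge_iff_cmTopWeightHodge (hW : CMWeights[]) : CMIdempotentHodge[] ↔ CMTopWeightHodge[] :=
  ⟨cmTopWeightHodge_of_cmIdempotentHodge, cmIdempotentHodge_of_cmTopWeightHodge hW⟩

/-! ### Rows -/

/-- **`HC_CM ∧ CMIdempotentHodge[] ⟹ HC_AV`, granted [h₂₁] and `CMLerayIdempotent[]`** (binders in this order; `HC_CM` =
`RankFourFaces.CMAbelianHodge` a HYPOTHESIS, load-bearing). THE CELL'S DELIVERABLE ON THE ANDRÉ AXIS IN IDEMPOTENT FORM: `HC_AV_of_HC_CM_and_Bmin`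
with, in the place of `B_min`, the CANDIDATE (4-binder reading of (L); not below N104, not minimal — F-ab-107) "the Hodge conjecture for the images
of the algebraic Leray idempotents of the total spaces of CM-pointed compact abelian pencils". research route, not a corollary; conditional on
HC_CM plus one named minimal statement. [cite: Andre1996Motifs, Lemme 6.3.1 (p. 31) and Remarque 2 (p. 33)] [cite: Milne2020HodgeClassesAV, proof of Prop. 1 (pp. 7–8)]
[cite: DeningerMurre1991, Thm. 3.1] -/
theorem HC_AV_of_HC_CM_of_cmIdempotentHodge (h₂₁ : andre1996_cmAnchoredPencil) (hE : CMLerayIdempotent[])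
    (hCM : RankFourFaces.CMAbelianHodge) (h : CMIdempotentHodge[]) : PadicSemiregularLift.HodgeAbelianVarieties :=
  HC_AV_of_HC_CM_and_cmFibreAlgebraicLift h₂₁ hCM (cmFibreAlgebraicLift_of_cmIdempotentHodge hE h)

/-- **EXACTNESS: `HC_AV ⟺ HC_CM ∧ CMIdempotentHodge[]`, granted [h₂₁], Verdier and `CMLerayIdempotent[]`.**
[cite: Andre1996Motifs, Lemme 6.3.1 (p. 31) and Remarque 2 (p. 33)] [cite: Verdier1976, Cor. 5.1] [cite: DeningerMurre1991, Thm. 3.1] -/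
theorem HC_AV_iff_HC_CM_and_cmIdempotentHodge_of_verdier (h₂₁ : andre1996_cmAnchoredPencil)
    (hGT : Verdier1976_genericLocalTriviality) (hE : CMLerayIdempotent[]) :
    PadicSemiregularLift.HodgeAbelianVarieties ↔ (RankFourFaces.CMAbelianHodge ∧ CMIdempotentHodge[]) :=
  ⟨fun h ↦ ⟨HC_CM_of_HC_AV h, cmIdempotentHodge_of_HC_AV_of_verdier hGT h⟩, fun h ↦ HC_AV_of_HC_CM_of_cmIdempotentHodge h₂₁ hE h.1 h.2⟩

/-- **`HC_CM ∧ CMIdempotentHodge[] ⟹ HC_AV`, granted [h₂₁] and (θ∀) `PencilTheta[]`** (the abelian-scheme structure supplies the idempotents).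
[cite: Andre1996Motifs, Lemme 6.3.1 (p. 31) and Remarque 2 (p. 33)] [cite: MumfordGIT, Thm. 6.14] [cite: DeningerMurre1991, Thm. 3.1] -/
theorem HC_AV_of_HC_CM_of_cmIdempotentHodge_of_theta (h₂₁ : andre1996_cmAnchoredPencil) (hΘ : PencilTheta[])
    (hCM : RankFourFaces.CMAbelianHodge) (h : CMIdempotentHodge[]) : PadicSemiregularLift.HodgeAbelianVarieties :=
  HC_AV_of_HC_CM_of_cmIdempotentHodge h₂₁ (cmLerayIdempotent_of_pencilTheta hΘ) hCM h

/-- **EXACTNESS: `HC_AV ⟺ HC_CM ∧ CMIdempotentHodge[]`, granted [h₂₁], Verdier and (θ∀) `PencilTheta[]`.**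
[cite: Andre1996Motifs, Lemme 6.3.1 (p. 31) and Remarque 2 (p. 33)] [cite: Verdier1976, Cor. 5.1] [cite: MumfordGIT, Thm. 6.14] -/
theorem HC_AV_iff_HC_CM_and_cmIdempotentHodge_of_verdier_of_theta (h₂₁ : andre1996_cmAnchoredPencil)
    (hGT : Verdier1976_genericLocalTriviality) (hΘ : PencilTheta[]) :
    PadicSemiregularLift.HodgeAbelianVarieties ↔ (RankFourFaces.CMAbelianHodge ∧ CMIdempotentHodge[]) :=
  HC_AV_iff_HC_CM_and_cmIdempotentHodge_of_verdier h₂₁ hGT (cmLerayIdempotent_of_pencilTheta hΘ)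

/-- **W₆ in idempotent form: `(W_E)₃ ∧ [at the `E`-power points `t` of the compact pencils of abelian sixfolds: in every degree `2p ≤ 12` an
algebraic Leray idempotent `e` at `t`, and every rational `(p,p)`-class of the SEVENFOLD fixed by `e` is algebraic] ⟹ WeilSixfolds`** (part
XXVII-a §4 ⟸ gives the lift in every degree — no hypothesis on the fibre is needed in this direction; then parts XXII-d / XXI-b §7 / XIX-f).
`HC_CM` IDLE; no named fact; `(W_E)₃` is an OPEN habitat node. FIND-THE-CYCLE: an algebraic 7-cycle on `𝒳⁷ × 𝒳⁷` acting on `H⁶(𝒳⁷)` as a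
Leray idempotent at the `E`-power point, and algebraic 3-cycles for the rational Hodge classes of its image (rank 3 with large monodromy).
research route, not a corollary; conditional on HC_CM plus one named minimal statement. [cite: vanGeemen1994HodgeAV, Thm. 6.12]
[cite: Andre1996Motifs, Lemme 6.3.3 (p. 33)] [cite: DeningerMurre1991, Thm. 3.1] -/
theorem weilSixfolds_of_cmPowerWeilPencilsAt_of_idempotentHodge (hW : CMPowerAnchoredCompactWeilPencilsAt 3)
    (h : ∀ ⦃𝒳 S : SchemeOver ℂ⦄ (f : 𝒳 ⟶ S) (_ : IsCompactAbelianPencil f 6) (t : ComplexPoints S), t ∈ cmPowerLocus f 6 →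
      ∀ p : ℕ, p ≤ 6 → ∃ e : complexBetti 𝒳 (2 * p) →ₗ[ℂ] complexBetti 𝒳 (2 * p),
        IsAlgebraicCorrespondence (6 + 1) (6 + 1) 𝒳 𝒳 e ∧ (∀ w, IsRationalClass w → IsRationalClass (e w)) ∧
        (∀ w, complexBetti.map (fiberι f t) (2 * p) (e w) = complexBetti.map (fiberι f t) (2 * p) w) ∧
        (∀ w, complexBetti.map (fiberι f t) (2 * p) w = 0 → e w = 0) ∧
        ∀ y₀ : complexBetti 𝒳 (2 * p), e y₀ = y₀ → IsRationalClass y₀ → IsOfHodgeType (6 + 1) 𝒳 (2 * p) p p y₀ →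
          y₀ ∈ algebraicClasses 𝒳 p) :
    Theses.SevenfoldWeilCensus.WeilSixfolds := by
  refine weilSixfolds_of_cmPowerWeilPencilsAt_of_primitiveLiftE hW ?_
  intro 𝒳 S f hf t ht K hKalg hKs r h2r hrd ξ hξ hP hI
  have hL : ∀ p : ℕ, (algebraicClasses (fiberOver f t) p).comap (complexBetti.map (fiberι f t) (2 * p)).hom ≤
      algebraicClasses 𝒳 p ⊔ LinearMap.ker (complexBetti.map (fiberι f t) (2 * p)).hom := by
    intro p
    rcases le_or_gt p 6 with hp | hp
    · obtain ⟨e, halg, hQ, hπ, hκ, hfix⟩ := h f hf t ht p hp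
      exact comap_le_sup_of_forall_fixed_hodge_mem hf t e halg hQ hπ hκ hfix
    · haveI := subsingleton_complexBetti (hf.isSmoothProjective_fiberOver t) (show 2 * 6 < 2 * p by omega)
      intro W _
      refine Submodule.mem_sup_right ?_
      rw [LinearMap.mem_ker]
      exact Subsingleton.elim _ _
  exact (forall_comap_le_sup_iff_primitiveLift hf t hKalg hKs).1 hL r h2r hrd ξ hξ hP hI

end Nodes

end Summit.HodgeConjecture.HodgeConjecture.Ring2.AbelianAll

end
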